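import Summits.QuantumFields.GaugeBoot.OneOverNExpansionUniform
import Summits.QuantumFields.GaugeBoot.OneOverNIdentification
import HarnessLib

/-!
# The `1/N` expansion to all orders: the master package (gauge-boot, ADDENDUM 30 part H)

HONEST FRAMING (cell `pub-gaugeboot`, page 1 of every file): the venture produces certified bounds
on lattice expectations at stated coupling, gauge group, dimension and torus size; NOT a mass gap,
NOT a continuum limit, NOT a string tension; NOT Yang–Mills-summit-bearing (barriers
`FixedCouplingUltralocality`, `PerturbativeInvisibility`).  Strong-coupling `SO(N)` lattice gauge theory with free boundary
condition (S. Chatterjee, Comm. Math. Phys. **366** (2019); S. Chatterjee, J. Jafarov, arXiv:1604.04777); nothing about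
four-dimensional continuum Yang–Mills or a mass gap.

## Content

Two abstract facts about ANY family `F` with the order-by-order properties of the lane's `1/N` expansion (values at `∅`,
exponential bounds, the recursion (5.2)) — `coeff_zero_eq_trajectorySum_of` (the zeroth coefficient is the string sum
`Σ_X w_β(X)`, by uniqueness for the symmetrized equation) and `hierarchy_unique_of` (Chatterjee–Jafarov's Theorem 5.6: the
recursion, the bounds and the values at `∅` determine the coefficients) — and ★★★ `oneOverN_master`, ONE function
`F` (`f_k = F_{k+2}`) carrying everything the lane proved: the expansion along super-logarithmic cubes (in particular along
`[−N, N]^d`), the uniform finite-`N`/finite-volume bound, `f_0 = Σ_X w_β(X)`, the recursion, the bounds, and uniqueness.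

Everything is `[folklore]` given the siblings.
-/

noncomputable section

open Filter Topology
open Literature.Probability.LatticeModels (Site box)
open Literature.MathematicalPhysics.QuantumFieldTheory (latticeNorm)
open Literature.MathematicalPhysics.QuantumFieldTheory.Chatterjee2019LargeN
open Literature.MathematicalPhysics.QuantumFieldTheory.Chatterjee2019LargeN.CoeffCatalanBoundProof

namespace Summit.QuantumFields.GaugeBoot

namespace StringDuality

variable {d : ℕ}

/-- **The zeroth coefficient is the string sum**, abstractly: a function with value `1` at `∅`, an exponential bound and the
homogeneous symmetrized master loop equation equals `Σ_{X ∈ 𝒳(s)} w_β(X)` for `|β|` small.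
[cite: Chatterjee2019LargeN, Theorem 3.1, Theorem 9.9, Theorem 11.1; ChatterjeeJafarov2016OneOverN, Theorem 5.3] -/
theorem coeff_zero_eq_trajectorySum_of {C₀ L₀ : ℝ} (hL : 1 ≤ L₀) :
    ∃ β₁ : ℝ, 0 < β₁ ∧ ∀ β : ℝ, |β| ≤ β₁ → ∀ g : LoopSeq d → ℝ, g [] = 1 →
      (∀ s : LoopSeq d, IsLoopSeq s → |g s| ≤ C₀ * L₀ ^ s.len) →
      (∀ s : LoopSeq d, IsLoopSeq s → s ≠ [] →
        (s.len : ℝ) * g s -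
            ((∑ o : InvIdx s, g (s.negSplitAt o)) - (∑ o : SameIdx s, g (s.posSplitAt o))
              + β * (∑ o : DeformIdx s, g (s.negDeformAt o)) - β * (∑ o : DeformIdx s, g (s.posDeformAt o))) = 0) →
      ∀ s : LoopSeq d, IsLoopSeq s → g s = ∑' X : Trajectory s, X.weight β := by
  have hKd := one_le_bigK d
  have hβT : (0 : ℝ) < 1 / (2 * bigK d ^ 5) := by positivity
  obtain ⟨βz, hβz, Uz⟩ := symmetrized_unique (d := d) (M := max C₀ 2) (L := max L₀ (4 * bigK d))
    (le_max_of_le_right (by norm_num)) (le_max_of_le_left hL)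
  refine ⟨min (1 / (2 * bigK d ^ 5)) βz, lt_min hβT hβz, fun β hβ g hnil hb heq s hs => ?_⟩
  have hbT : |β| ≤ 1 / (2 * bigK d ^ 5) := hβ.trans (min_le_left _ _)
  refine Uz β (hβ.trans (min_le_right _ _)) g (fun t => ∑' X : Trajectory t, X.weight β) (by rw [hnil, trajectorySum_nil])
    (fun t ht => (hb t ht).trans ?_) (fun t ht => (trajectorySum_summable_and_abs_le hbT ht).2.trans ?_)
    (fun t ht hne => by linarith [heq t ht hne]) (fun t ht hne => trajectorySum_equation hbT ht hne) s hs
  · exact mul_le_mul (le_max_left _ _) (pow_le_pow_left₀ (by linarith) (le_max_left _ _) _)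
      (pow_nonneg (by linarith) _) (le_max_of_le_right (by norm_num))
  · exact mul_le_mul (le_max_right _ _) (pow_le_pow_left₀ (by positivity) (le_max_right _ _) _)
      (pow_nonneg (by positivity) _) (le_max_of_le_right (by norm_num))

/-- **Uniqueness of the coefficient hierarchy** (Chatterjee–Jafarov, Theorem 5.6), abstractly: if `F` has, order by order for
`|β| ≤ β₀(k)`, the values at `∅`, bounds `C_k L_k^{|s|}` (`L_k ≥ 1`) and the recursion, then for every `k` and class
`(M, L)` there is `β₁ > 0` such that for `|β| ≤ β₁` any `G_0 = G_1 = 0, G_2, …, G_{k+2}` of class `M L^{|s|}` with the same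
values at `∅` and the same recursion agree with `F` up to level `k + 2` on genuine loop sequences.
[cite: ChatterjeeJafarov2016OneOverN, Theorem 5.6] -/
theorem hierarchy_unique_of {F : ℕ → ℝ → LoopSeq d → ℝ} {β₀ C L : ℕ → ℝ} (hpos : ∀ k, 0 < β₀ k)
    (hL : ∀ k, 1 ≤ L k)
    (hF0 : ∀ (β : ℝ) (u : LoopSeq d), F 0 β u = 0) (hF1 : ∀ (β : ℝ) (u : LoopSeq d), F 1 β u = 0)
    (hA : ∀ (k : ℕ) (β : ℝ), |β| ≤ β₀ k →
      F (k + 2) β [] = (if k = 0 then 1 else 0) ∧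
      (∀ s : LoopSeq d, IsLoopSeq s → |F (k + 2) β s| ≤ C k * L k ^ s.len) ∧
      (∀ s : LoopSeq d, IsLoopSeq s → s ≠ [] →
        (s.len : ℝ) * F (k + 2) β s -
            ((∑ o : InvIdx s, F (k + 2) β (s.negSplitAt o)) - (∑ o : SameIdx s, F (k + 2) β (s.posSplitAt o))
              + β * (∑ o : DeformIdx s, F (k + 2) β (s.negDeformAt o))
              - β * (∑ o : DeformIdx s, F (k + 2) β (s.posDeformAt o))) =
          (s.len : ℝ) * F (k + 1) β s
            + ((∑ o : SameIdx s, F (k + 1) β (s.negTwistAt o)) - ∑ o : InvIdx s, F (k + 1) β (s.posTwistAt o))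
            + ((∑ o : MergeIdx s, F k β (s.negMergeAt o)) - ∑ o : MergeIdx s, F k β (s.posMergeAt o)))) :
    ∀ (k : ℕ) (Mb Lb : ℝ), 0 ≤ Mb → 1 ≤ Lb → ∃ β₁ : ℝ, 0 < β₁ ∧ ∀ β : ℝ, |β| ≤ β₁ → ∀ G : ℕ → LoopSeq d → ℝ,
      (∀ u : LoopSeq d, G 0 u = 0) → (∀ u : LoopSeq d, G 1 u = 0) →
      (∀ i, i ≤ k → G (i + 2) [] = if i = 0 then 1 else 0) →
      (∀ i, i ≤ k → ∀ s : LoopSeq d, IsLoopSeq s → |G (i + 2) s| ≤ Mb * Lb ^ s.len) →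
      (∀ i, i ≤ k → ∀ s : LoopSeq d, IsLoopSeq s → s ≠ [] →
        (s.len : ℝ) * G (i + 2) s -
            ((∑ o : InvIdx s, G (i + 2) (s.negSplitAt o)) - (∑ o : SameIdx s, G (i + 2) (s.posSplitAt o))
              + β * (∑ o : DeformIdx s, G (i + 2) (s.negDeformAt o)) - β * (∑ o : DeformIdx s, G (i + 2) (s.posDeformAt o))) =
          (s.len : ℝ) * G (i + 1) s
            + ((∑ o : SameIdx s, G (i + 1) (s.negTwistAt o)) - ∑ o : InvIdx s, G (i + 1) (s.posTwistAt o))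
            + ((∑ o : MergeIdx s, G i (s.negMergeAt o)) - ∑ o : MergeIdx s, G i (s.posMergeAt o))) →
      ∀ i, i ≤ k → ∀ s : LoopSeq d, IsLoopSeq s → G (i + 2) s = F (i + 2) β s := by
  intro k
  induction k with
  | zero =>
    intro Mb Lb hMb hLb
    obtain ⟨βw, hβw, Uw⟩ := sourced_symmetrized_unique (d := d) (M := max Mb (C 0)) (L := max Lb (L 0))
      (le_max_of_le_left hMb) (le_max_of_le_left hLb)
    refine ⟨min (β₀ 0) βw, lt_min (hpos 0) hβw, fun β hβ G hG0 hG1 hGnil hGb hGeq i hi s hs => ?_⟩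
    obtain rfl : i = 0 := Nat.le_zero.mp hi
    have hb0 : |β| ≤ β₀ 0 := hβ.trans (min_le_left _ _)
    obtain ⟨hnil, hbd, heq⟩ := hA 0 β hb0
    refine Uw β (hβ.trans (min_le_right _ _)) (fun _ => 0) (G 2) (F 2 β)
      (by rw [hGnil 0 le_rfl, hnil]) (fun t ht => (hGb 0 le_rfl t ht).trans ?_)
      (fun t ht => (hbd t ht).trans ?_) (fun t ht hne => ?_) (fun t ht hne => ?_) s hs
    · exact mul_le_mul (le_max_left _ _) (pow_le_pow_left₀ (by linarith) (le_max_left _ _) _)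
        (pow_nonneg (by linarith) _) (le_max_of_le_left hMb)
    · exact mul_le_mul (le_max_right _ _) (pow_le_pow_left₀ (by linarith [hL 0]) (le_max_right _ _) _)
        (pow_nonneg (by linarith [hL 0]) _) (le_max_of_le_left hMb)
    · have h := hGeq 0 le_rfl t ht hne
      simp only [hG0, hG1, mul_zero, Finset.sum_const_zero, sub_self, add_zero] at h
      exact h
    · have h := heq t ht hne
      simp only [hF0, hF1, mul_zero, Finset.sum_const_zero, sub_self, add_zero] at h
      exact h
  | succ k ih =>
    intro Mb Lb hMb hLb
    obtain ⟨βk, hβk, Uk⟩ := ih Mb Lb hMb hLb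
    obtain ⟨βw, hβw, Uw⟩ := sourced_symmetrized_unique (d := d) (M := max Mb (C (k + 1))) (L := max Lb (L (k + 1)))
      (le_max_of_le_left hMb) (le_max_of_le_left hLb)
    refine ⟨min βk (min (β₀ (k + 1)) βw), lt_min hβk (lt_min (hpos _) hβw),
      fun β hβ G hG0 hG1 hGnil hGb hGeq i hi s hs => ?_⟩
    have hbk : |β| ≤ βk := hβ.trans (min_le_left _ _)
    have hb1 : |β| ≤ β₀ (k + 1) := hβ.trans ((min_le_right _ _).trans (min_le_left _ _))
    have hbw : |β| ≤ βw := hβ.trans ((min_le_right _ _).trans (min_le_right _ _))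
    have hlow : ∀ i, i ≤ k → ∀ t : LoopSeq d, IsLoopSeq t → G (i + 2) t = F (i + 2) β t :=
      Uk β hbk G hG0 hG1 (fun i hi => hGnil i (Nat.le_succ_of_le hi)) (fun i hi => hGb i (Nat.le_succ_of_le hi))
        (fun i hi => hGeq i (Nat.le_succ_of_le hi))
    rcases Nat.lt_or_ge i (k + 1) with hik | hik
    · exact hlow i (Nat.lt_succ_iff.mp hik) s hs
    obtain rfl : i = k + 1 := le_antisymm hi hik
    obtain ⟨hnil, hbd, heq⟩ := hA (k + 1) β hb1
    have hprev : ∀ t : LoopSeq d, IsLoopSeq t → G (k + 2) t = F (k + 2) β t := hlow k le_rfl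
    have hprev' : ∀ t : LoopSeq d, IsLoopSeq t → G (k + 1) t = F (k + 1) β t := by
      intro t ht
      rcases k with _ | k
      · rw [hG1, hF1]
      · exact hlow k (Nat.le_succ k) t ht
    refine Uw β hbw (fun t => (t.len : ℝ) * F (k + 2) β t
        + ((∑ o : SameIdx t, F (k + 2) β (t.negTwistAt o)) - ∑ o : InvIdx t, F (k + 2) β (t.posTwistAt o))
        + ((∑ o : MergeIdx t, F (k + 1) β (t.negMergeAt o)) - ∑ o : MergeIdx t, F (k + 1) β (t.posMergeAt o)))
      (G (k + 1 + 2)) (F (k + 1 + 2) β) (by rw [hGnil (k + 1) le_rfl, hnil])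
      (fun t ht => (hGb (k + 1) le_rfl t ht).trans ?_) (fun t ht => (hbd t ht).trans ?_)
      (fun t ht hne => ?_) (fun t ht hne => heq t ht hne) s hs
    · exact mul_le_mul (le_max_left _ _) (pow_le_pow_left₀ (by linarith) (le_max_left _ _) _)
        (pow_nonneg (by linarith) _) (le_max_of_le_left hMb)
    · exact mul_le_mul (le_max_right _ _) (pow_le_pow_left₀ (by linarith [hL (k + 1)]) (le_max_right _ _) _)
        (pow_nonneg (by linarith [hL (k + 1)]) _) (le_max_of_le_left hMb)
    · rw [hGeq (k + 1) le_rfl t ht hne, hprev t ht]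
      simp only [hprev _ (ht.negTwistAt _), hprev _ (ht.posTwistAt _), hprev' _ (ht.negMergeAt _),
        hprev' _ (ht.posMergeAt _)]

variable (d)

/-- ★★★ **The `1/N` expansion of strongly coupled `SO(N)` lattice gauge theory — master package.**  For `d ≥ 2` there are
`β₀(d,0) ≥ β₀(d,1) ≥ ⋯ > 0`, `C_k ≥ 0`, `L_k ≥ 1` and ONE family `F` (`f_k := F_{k+2}`, `F₀ = F₁ = 0`) such that:
(A) for every `k`, `|β| ≤ β₀(d,k)`: `f_0(∅) = 1`, `f_k(∅) = 0` (`k ≥ 1`); `|f_k| ≤ C_k L_k^{|s|}`; the recursion (5.2); for every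
sequence of cubes `[−M_N,M_N]^d` with `a·log₂N ≤ M_N` eventually (all `a`), and along `[−N,N]^d`, for every genuine `s`:
`N^k(⟨W_{l₁}⋯W_{lₙ}⟩_{Λ_N,N,β}/Nⁿ − Σ_{i<k} f_i(s)N^{−i}) → f_k(s)`; and the UNIFORM bound: for every finite `Λ`, `N ≥ 2` and
genuine `s` at depth `4k(log₂N+3)` in `Λ`, `|N^k(⟨W⟩_{Λ,N,β}/Nⁿ − Σ_{i<k} f_i N^{−i})| ≤ C_k L_k^{|s|}`;
(B) `f_0(β, s) = Σ_{X ∈ 𝒳(s)} w_β(X)` for `|β| ≤ β₀(d,0)`;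
(C) uniqueness of the hierarchy (Chatterjee–Jafarov, Theorem 5.6).
[cite: ChatterjeeJafarov2016OneOverN, Theorem 3.1 (ii), (iii), Theorem 5.1, Theorem 5.6; Chatterjee2019LargeN, Theorems 3.1, 3.6, 9.9] -/
theorem oneOverN_master (hd : 2 ≤ d) :
    ∃ β₀ : ℕ → ℝ, (∀ k, 0 < β₀ k) ∧ (∀ k, β₀ (k + 1) ≤ β₀ k) ∧
    ∃ C L : ℕ → ℝ, (∀ k, 0 ≤ C k) ∧ (∀ k, 1 ≤ L k) ∧ ∃ F : ℕ → ℝ → LoopSeq d → ℝ,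
      (∀ (β : ℝ) (u : LoopSeq d), F 0 β u = 0) ∧ (∀ (β : ℝ) (u : LoopSeq d), F 1 β u = 0) ∧
      (∀ (k : ℕ) (β : ℝ), |β| ≤ β₀ k →
        F (k + 2) β [] = (if k = 0 then 1 else 0) ∧
        (∀ s : LoopSeq d, IsLoopSeq s → |F (k + 2) β s| ≤ C k * L k ^ s.len) ∧
        (∀ s : LoopSeq d, IsLoopSeq s → s ≠ [] →
          (s.len : ℝ) * F (k + 2) β s -
              ((∑ o : InvIdx s, F (k + 2) β (s.negSplitAt o)) - (∑ o : SameIdx s, F (k + 2) β (s.posSplitAt o))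
                + β * (∑ o : DeformIdx s, F (k + 2) β (s.negDeformAt o))
                - β * (∑ o : DeformIdx s, F (k + 2) β (s.posDeformAt o))) =
            (s.len : ℝ) * F (k + 1) β s
              + ((∑ o : SameIdx s, F (k + 1) β (s.negTwistAt o)) - ∑ o : InvIdx s, F (k + 1) β (s.posTwistAt o))
              + ((∑ o : MergeIdx s, F k β (s.negMergeAt o)) - ∑ o : MergeIdx s, F k β (s.posMergeAt o))) ∧
        (∀ M : ℕ → ℕ, (∀ a : ℕ, ∀ᶠ N : ℕ in atTop, a * Nat.log 2 N ≤ M N) → ∀ s : LoopSeq d, IsLoopSeq s →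
          Tendsto (fun N : ℕ => (N : ℝ) ^ k *
            (phi N β (box d (M N)) s - ∑ i ∈ Finset.range k, F (i + 2) β s / (N : ℝ) ^ i)) atTop (𝓝 (F (k + 2) β s))) ∧
        (∀ s : LoopSeq d, IsLoopSeq s →
          Tendsto (fun N : ℕ => (N : ℝ) ^ k *
            (phi N β (box d N) s - ∑ i ∈ Finset.range k, F (i + 2) β s / (N : ℝ) ^ i)) atTop (𝓝 (F (k + 2) β s))) ∧
        (∀ (Λ : Finset (Site d)) (N : ℕ), 2 ≤ N → ∀ s : LoopSeq d, IsLoopSeq s →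
          (∀ l ∈ s, ∀ e ∈ l, ∀ v : Site d,
            latticeNorm (v - DEdge.src e) ≤ ((k * (4 * (Nat.log 2 N + 3)) : ℕ) : ℝ) ∨
              latticeNorm (v - DEdge.tgt e) ≤ ((k * (4 * (Nat.log 2 N + 3)) : ℕ) : ℝ) → v ∈ Λ) →
          |(N : ℝ) ^ k * (phi N β Λ s - ∑ i ∈ Finset.range k, F (i + 2) β s / (N : ℝ) ^ i)| ≤ C k * L k ^ s.len)) ∧
      (∀ β : ℝ, |β| ≤ β₀ 0 → ∀ s : LoopSeq d, IsLoopSeq s → F 2 β s = ∑' X : Trajectory s, X.weight β) ∧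
      (∀ (k : ℕ) (Mb Lb : ℝ), 0 ≤ Mb → 1 ≤ Lb → ∃ β₁ : ℝ, 0 < β₁ ∧ ∀ β : ℝ, |β| ≤ β₁ → ∀ G : ℕ → LoopSeq d → ℝ,
        (∀ u : LoopSeq d, G 0 u = 0) → (∀ u : LoopSeq d, G 1 u = 0) →
        (∀ i, i ≤ k → G (i + 2) [] = if i = 0 then 1 else 0) →
        (∀ i, i ≤ k → ∀ s : LoopSeq d, IsLoopSeq s → |G (i + 2) s| ≤ Mb * Lb ^ s.len) →
        (∀ i, i ≤ k → ∀ s : LoopSeq d, IsLoopSeq s → s ≠ [] →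
          (s.len : ℝ) * G (i + 2) s -
              ((∑ o : InvIdx s, G (i + 2) (s.negSplitAt o)) - (∑ o : SameIdx s, G (i + 2) (s.posSplitAt o))
                + β * (∑ o : DeformIdx s, G (i + 2) (s.negDeformAt o)) - β * (∑ o : DeformIdx s, G (i + 2) (s.posDeformAt o))) =
            (s.len : ℝ) * G (i + 1) s
              + ((∑ o : SameIdx s, G (i + 1) (s.negTwistAt o)) - ∑ o : InvIdx s, G (i + 1) (s.posTwistAt o))
              + ((∑ o : MergeIdx s, G i (s.negMergeAt o)) - ∑ o : MergeIdx s, G i (s.posMergeAt o))) →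
        ∀ i, i ≤ k → ∀ s : LoopSeq d, IsLoopSeq s → G (i + 2) s = F (i + 2) β s) := by
  obtain ⟨β₀, hpos, hanti, C, L, F, hF0, hF1, H⟩ := oneOverN_expansion_uniform d hd
  have hnilS : IsLoopSeq ([] : LoopSeq d) := fun l hl => by simp at hl
  -- normalised constants
  have hC0 : ∀ k, 0 ≤ C k := by
    intro k
    obtain ⟨hnil, hb, -⟩ := H k 0 (by rw [abs_zero]; exact (hpos k).le)
    have h := hb [] hnilS
    rw [hnil, LoopSeq.len_nil, pow_zero, mul_one] at h
    split_ifs at h <;> linarith [abs_nonneg (1 : ℝ), abs_nonneg (0 : ℝ), h]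
  set L' : ℕ → ℝ := fun k => max |L k| 1 with hL'
  have hL'1 : ∀ k, 1 ≤ L' k := fun k => le_max_right _ _
  have hLL' : ∀ (k : ℕ) (s : LoopSeq d), C k * L k ^ s.len ≤ C k * L' k ^ s.len := by
    intro k s
    refine mul_le_mul_of_nonneg_left ?_ (hC0 k)
    calc L k ^ s.len ≤ |L k ^ s.len| := le_abs_self _
      _ = |L k| ^ s.len := abs_pow _ _
      _ ≤ L' k ^ s.len := pow_le_pow_left₀ (abs_nonneg _) (le_max_left _ _) _
  have hA : ∀ (k : ℕ) (β : ℝ), |β| ≤ β₀ k →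
      F (k + 2) β [] = (if k = 0 then 1 else 0) ∧
      (∀ s : LoopSeq d, IsLoopSeq s → |F (k + 2) β s| ≤ C k * L' k ^ s.len) ∧
      (∀ s : LoopSeq d, IsLoopSeq s → s ≠ [] →
        (s.len : ℝ) * F (k + 2) β s -
            ((∑ o : InvIdx s, F (k + 2) β (s.negSplitAt o)) - (∑ o : SameIdx s, F (k + 2) β (s.posSplitAt o))
              + β * (∑ o : DeformIdx s, F (k + 2) β (s.negDeformAt o))
              - β * (∑ o : DeformIdx s, F (k + 2) β (s.posDeformAt o))) =
          (s.len : ℝ) * F (k + 1) β s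
            + ((∑ o : SameIdx s, F (k + 1) β (s.negTwistAt o)) - ∑ o : InvIdx s, F (k + 1) β (s.posTwistAt o))
            + ((∑ o : MergeIdx s, F k β (s.negMergeAt o)) - ∑ o : MergeIdx s, F k β (s.posMergeAt o))) := by
    intro k β hβ
    obtain ⟨h1, h2, h3, -⟩ := H k β hβ
    exact ⟨h1, fun s hs => (h2 s hs).trans (hLL' k s), h3⟩
  -- (B)
  obtain ⟨β₁, hβ₁, HB⟩ := coeff_zero_eq_trajectorySum_of (d := d) (C₀ := C 0) (hL'1 0)
  have hpos' : ∀ k, 0 < min (β₀ k) β₁ := fun k => lt_min (hpos k) hβ₁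
  refine ⟨fun k => min (β₀ k) β₁, hpos', fun k => min_le_min (hanti k) le_rfl, C, L', hC0, hL'1, F, hF0, hF1,
    fun k β hβ => ?_, fun β hβ s hs => ?_,
    hierarchy_unique_of hpos' hL'1 hF0 hF1 (fun k β hβ => hA k β (hβ.trans (min_le_left _ _)))⟩
  · have hb : |β| ≤ β₀ k := hβ.trans (min_le_left _ _)
    obtain ⟨h1, h2, h3, h4, h5⟩ := H k β hb
    exact ⟨h1, fun s hs => (h2 s hs).trans (hLL' k s), h3, h4, fun s hs => h4 (fun N => N) superlog_linear s hs,
      fun Λ N hN s hs hball => (h5 Λ N hN s hs hball).trans (hLL' k s)⟩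
  · obtain ⟨h1, h2, h3⟩ := hA 0 β (hβ.trans (min_le_left _ _))
    exact HB β (hβ.trans (min_le_right _ _)) (F 2 β) (by rw [h1, if_pos rfl]) h2
      (fun t ht hne => by
        have h := h3 t ht hne
        simp only [hF0, hF1, mul_zero, Finset.sum_const_zero, sub_self, add_zero] at h
        exact h) s hs

end StringDuality

end Summit.QuantumFields.GaugeBoot

end
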